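import Mathlib
import HarnessLib
import Summits.CriticalPhenomena.PercolationContinuityZ3.Theorems.PercTreeValueTetrahedronHarrisGapStubNoiseWindowExpansion
import Literature.Probability.Percolation.BlockConditioning

/-!
# Noise expansion over a finite window, II: the two-bit expansion and the one-bit covariance
# (infrastructure for `stub_noiseWindow`, line `noise_bridges`, crux `TetrahedronHarrisGap`, stmt-CriticalPhenomena-7799)

Lead prover-line-stmt-CriticalPhenomena-7799-c3-0.  `P = bondPercolation G p`, two replicas `(ω, ω') ∼ P ⊗ P`, an edge `f ∈ E(G)`,
`ω^{f,1} = insert f ω`, `ω^{f,0} = ω ∖ {f}`: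

* `twoReplica_twoBit_expansion` — `E_{P⊗P}[H] = Σ_{i,j ⊆ {f}} P{obs = i} P{obs = j} E[H(ω ∖ {f} ∪ i, ω' ∖ {f} ∪ j)]` for bounded
  measurable `H` (finite Fubini over the one-edge block in each replica, `integral_eq_sum_powerset`);
* `twoReplica_sub_insert_eq` (registered) — the ONE-BIT COVARIANCE: for increasing measurable `A, B` and `f ∈ E(G) ∖ T`,
  `(P⊗P){ω ∈ A, resample T ∈ B} − (P⊗P){ω ∈ A, resample (insert f T) ∈ B} = p(1−p)·(P⊗P){f ∈ Piv_A(ω), f ∈ Piv_B(resample T)}`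
  ("resampling one more edge costs exactly the co-pivotal probability"; Kalai–Keller–Mossel arXiv:1511.04600,
  Radhakrishnan–Tassion arXiv:2410.23250 Prop. 1): two-bit expansion of both sides, `Σ_i p_i E[a_i b_i] − Σ_{i,j} p_i p_j E[a_i b_j]
  = p(1−p) E[(a_1−a_0)(b_1−b_0)]`, and the bracket is the co-pivotality indicator.
-/

noncomputable section

namespace Summit.CriticalPhenomena.PercolationContinuityZ3.Theorems.TetrahedronHarrisGap

open MeasureTheory
open Literature.Probability.Percolation Literature.Probability.LatticeModels

variable {V : Type*}

/-! ### The two-bit expansion and the one-bit covariance -/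

section TwoReplica

variable [Countable V] (G : SimpleGraph V) (p : unitInterval)

omit [Countable V] in
/-- The one-edge weights: `P{obs ω {f} = ∅} = 1 − p`, `P{obs ω {f} = {f}} = p` for an edge `f` of `G`. -/
theorem real_setOf_obs_singleton (f : Sym2 V) (hf : f ∈ G.edgeSet) :
    (bondPercolation G p).real {ω : BondConfig V | obs ω {f} = ∅} = 1 - p ∧
      (bondPercolation G p).real {ω : BondConfig V | obs ω {f} = {f}} = p := by
  classical
  have hW : (↑({f} : Finset (Sym2 V)) : Set (Sym2 V)) ⊆ G.edgeSet := by simpa using hf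
  refine ⟨?_, ?_⟩
  · rw [real_setOf_obs_eq_prod G p hW (Finset.empty_subset _)]
    simp
  · rw [real_setOf_obs_eq_prod G p hW subset_rfl]
    simp

omit [Countable V] in
/-- Gluing the one-edge pattern: `ω ∖ {f} ∪ ∅ = ω ∖ {f}` and `ω ∖ {f} ∪ {f} = insert f ω`. -/
theorem sdiff_union_singleton_cases (f : Sym2 V) (ω : BondConfig V) :
    ω \ (↑({f} : Finset (Sym2 V)) : Set (Sym2 V)) ∪ (↑(∅ : Finset (Sym2 V)) : Set (Sym2 V)) = ω \ {f} ∧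
      ω \ (↑({f} : Finset (Sym2 V)) : Set (Sym2 V)) ∪ (↑({f} : Finset (Sym2 V)) : Set (Sym2 V)) = insert f ω := by
  simp only [Finset.coe_singleton, Finset.coe_empty, Set.union_empty, Set.union_singleton, Set.insert_sdiff_singleton,
    and_self]

/-- **Two-bit expansion.**  For a bounded measurable `H` on two replicas and an edge `f` of `G`,
`E_{P⊗P}[H] = Σ_{i,j ⊆ {f}} P{obs = i} P{obs = j} · E_{P⊗P}[H(ω ∖ {f} ∪ i, ω' ∖ {f} ∪ j)]`
(finite Fubini over the one-edge block `{f}` in each replica, `integral_eq_sum_powerset`). -/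
theorem twoReplica_twoBit_expansion (f : Sym2 V) {H : BondConfig V × BondConfig V → ℝ} (hHm : Measurable H)
    {K : ℝ} (hHK : ∀ y, |H y| ≤ K) :
    ∫ y, H y ∂((bondPercolation G p).prod (bondPercolation G p)) =
      ∑ i ∈ ({f} : Finset (Sym2 V)).powerset, ∑ j ∈ ({f} : Finset (Sym2 V)).powerset,
        (bondPercolation G p).real {ω : BondConfig V | obs ω {f} = i} *
          ((bondPercolation G p).real {ω : BondConfig V | obs ω {f} = j} *
            ∫ y, H (y.1 \ ↑({f} : Finset (Sym2 V)) ∪ ↑i, y.2 \ ↑({f} : Finset (Sym2 V)) ∪ ↑j)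
              ∂((bondPercolation G p).prod (bondPercolation G p))) := by
  set P := bondPercolation G p with hP
  -- integrability / measurability bookkeeping
  have hK0 : 0 ≤ K := le_trans (abs_nonneg _) (hHK (∅, ∅))
  have hint : ∀ (φ : BondConfig V × BondConfig V → BondConfig V × BondConfig V), Measurable φ →
      Integrable (fun y => H (φ y)) (P.prod P) := fun φ hφ =>
    Integrable.of_bound ((hHm.comp hφ).aestronglyMeasurable) K
      (ae_of_all _ fun y => by rw [Real.norm_eq_abs]; exact hHK _)
  have hmod : ∀ i j : Finset (Sym2 V), Measurable fun y : BondConfig V × BondConfig V =>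
      (y.1 \ ↑({f} : Finset (Sym2 V)) ∪ ↑i, y.2 \ ↑({f} : Finset (Sym2 V)) ∪ ↑j) := fun i j =>
    ((measurable_sdiff_union {f} _).comp measurable_fst).prodMk ((measurable_sdiff_union {f} _).comp measurable_snd)
  -- Fubini: `E[H] = ∫_ω ∫_{ω'} H`
  rw [integral_prod _ (by simpa using hint id measurable_id)]
  -- inner expansion over the block `{f}` of the second replica
  have hinner : ∀ ω, ∫ ω', H (ω, ω') ∂P =
      ∑ j ∈ ({f} : Finset (Sym2 V)).powerset, P.real {ω' : BondConfig V | obs ω' {f} = j} *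
        ∫ ω', H (ω, ω' \ ↑({f} : Finset (Sym2 V)) ∪ ↑j) ∂P := fun ω =>
    integral_eq_sum_powerset G p {f} (F := fun ω' => H (ω, ω')) (hHm.comp measurable_prodMk_left) (fun ω' => hHK _)
  simp_rw [hinner]
  rw [integral_finsetSum _ (fun j _ => ?_)]
  swap
  · -- integrability of `ω ↦ c_j ∫ H(ω, ω'^j)`
    refine (Integrable.of_bound ?_ K (ae_of_all _ fun ω => ?_)).const_mul _
    · exact (StronglyMeasurable.integral_prod_right'
        ((hHm.comp ((measurable_fst).prodMk ((measurable_sdiff_union {f} _).comp measurable_snd))).stronglyMeasurable)).aestronglyMeasurable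
    · rw [Real.norm_eq_abs]
      refine (abs_integral_le_integral_abs).trans ?_
      refine (integral_mono_of_nonneg (ae_of_all _ fun _ => abs_nonneg _) (integrable_const K)
        (ae_of_all _ fun ω' => hHK _)).trans ?_
      simp
  rw [Finset.sum_comm]
  refine Finset.sum_congr rfl fun j _ => ?_
  rw [integral_const_mul]
  -- outer expansion over the block `{f}` of the first replica
  have houter := integral_eq_sum_powerset G p {f}
    (F := fun ω => ∫ ω', H (ω, ω' \ ↑({f} : Finset (Sym2 V)) ∪ ↑j) ∂P)
    ((StronglyMeasurable.integral_prod_right'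
        ((hHm.comp ((measurable_fst).prodMk ((measurable_sdiff_union {f} _).comp measurable_snd))).stronglyMeasurable)).measurable)
    (K := K) (fun ω => by
      refine (abs_integral_le_integral_abs).trans ?_
      refine (integral_mono_of_nonneg (ae_of_all _ fun _ => abs_nonneg _) (integrable_const K)
        (ae_of_all _ fun ω' => hHK _)).trans ?_
      simp)
  rw [houter, Finset.mul_sum]
  refine Finset.sum_congr rfl fun i _ => ?_
  rw [integral_prod _ (hint _ (hmod i j))]
  ring


omit [Countable V] in
/-- The powerset of a one-edge block. -/
theorem powerset_singleton_edge [DecidableEq V] (f : Sym2 V) :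
    ({f} : Finset (Sym2 V)).powerset = {∅, {f}} := by
  ext S
  simp [Finset.subset_singleton_iff]

omit [Countable V] in
/-- Resampling `T ∌ f` after rewriting the `f`-bits of both replicas: the `f`-bit of the result is the FIRST pattern. -/
theorem resample_sdiff_union_of_notMem [DecidableEq V] {T : Finset (Sym2 V)} {f : Sym2 V} (hfT : f ∉ T)
    (i j : Finset (Sym2 V)) (hi : i ⊆ {f}) (hj : j ⊆ {f}) (y : BondConfig V × BondConfig V) :
    resample (↑T : Set (Sym2 V)) (y.1 \ ↑({f} : Finset (Sym2 V)) ∪ ↑i, y.2 \ ↑({f} : Finset (Sym2 V)) ∪ ↑j) =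
      resample (↑T : Set (Sym2 V)) y \ {f} ∪ ↑i := by
  ext e
  by_cases he : e = f
  · subst he
    simp [mem_resample_iff, hfT]
  · have hi' : e ∉ i := fun h => he (Finset.mem_singleton.1 (hi h))
    have hj' : e ∉ j := fun h => he (Finset.mem_singleton.1 (hj h))
    simp [mem_resample_iff, he, hi', hj']

omit [Countable V] in
/-- Resampling `insert f T` (`f ∉ T`) after rewriting the `f`-bits: the `f`-bit of the result is the SECOND pattern. -/
theorem resample_insert_sdiff_union_of_notMem [DecidableEq V] {T : Finset (Sym2 V)} {f : Sym2 V} (hfT : f ∉ T)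
    (i j : Finset (Sym2 V)) (hi : i ⊆ {f}) (hj : j ⊆ {f}) (y : BondConfig V × BondConfig V) :
    resample (↑(insert f T) : Set (Sym2 V)) (y.1 \ ↑({f} : Finset (Sym2 V)) ∪ ↑i, y.2 \ ↑({f} : Finset (Sym2 V)) ∪ ↑j) =
      resample (↑T : Set (Sym2 V)) y \ {f} ∪ ↑j := by
  ext e
  by_cases he : e = f
  · subst he
    simp [mem_resample_iff, hfT]
  · have hi' : e ∉ i := fun h => he (Finset.mem_singleton.1 (hi h))
    have hj' : e ∉ j := fun h => he (Finset.mem_singleton.1 (hj h))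
    simp [mem_resample_iff, he, hi', hj']

omit [Countable V] in
/-- For an increasing event, the one-bit difference of indicators is the pivotality indicator:
`𝟙_A(insert f ω) − 𝟙_A(ω ∖ {f}) = 𝟙{f ∈ Piv_A(ω)}`. -/
theorem indicator_insert_sub_indicator_sdiff {A : Set (BondConfig V)} (hA : IsUpperSet A) (f : Sym2 V)
    (ω : BondConfig V) :
    A.indicator (1 : BondConfig V → ℝ) (insert f ω) - A.indicator (1 : BondConfig V → ℝ) (ω \ {f}) =
      {ω' : BondConfig V | IsPivotal A f ω'}.indicator (1 : BondConfig V → ℝ) ω := by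
  have hpiv : ω ∈ {ω' : BondConfig V | IsPivotal A f ω'} ↔ insert f ω ∈ A ∧ ω \ {f} ∉ A :=
    isPivotal_iff_of_isUpperSet hA f ω
  by_cases h1 : insert f ω ∈ A
  · by_cases h0 : ω \ {f} ∈ A
    · rw [Set.indicator_of_mem h1, Set.indicator_of_mem h0,
        Set.indicator_of_notMem (fun h => (hpiv.1 h).2 h0)]
      simp
    · rw [Set.indicator_of_mem h1, Set.indicator_of_notMem h0, Set.indicator_of_mem (hpiv.2 ⟨h1, h0⟩)]
      simp
  · have h0 : ω \ {f} ∉ A := fun h0 => h1 (hA (Set.sdiff_subset.trans (Set.subset_insert f ω)) h0)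
    rw [Set.indicator_of_notMem h1, Set.indicator_of_notMem h0,
      Set.indicator_of_notMem (fun h => h1 (hpiv.1 h).1)]
    simp

end TwoReplica

/-- **The one-bit covariance** ("resampling one more edge costs exactly the co-pivotal probability",
Kalai–Keller–Mossel arXiv:1511.04600; Radhakrishnan–Tassion arXiv:2410.23250 Prop. 1).  For increasing measurable
`A, B`, an edge `f ∈ E(G) ∖ T`:
`(P⊗P){ω ∈ A, resample T ∈ B} − (P⊗P){ω ∈ A, resample (insert f T) ∈ B} = p(1−p)·(P⊗P){f ∈ Piv_A(ω), f ∈ Piv_B(resample T)}`.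
Proof: two-bit expansion of both sides; with `a_i = 𝟙_A(ω^{f,i})`, `b_j = 𝟙_B(ξ^{f,j})` (`ξ = resample T`), the left side is
`Σ_i p_i E[a_i b_i] − Σ_{i,j} p_i p_j E[a_i b_j] = p(1−p) E[(a_1 − a_0)(b_1 − b_0)]`, and the bracket is the co-pivotality indicator. -/
theorem twoReplica_sub_insert_eq {V : Type*} [Countable V] [DecidableEq V] (G : SimpleGraph V) (p : unitInterval)
    (f : Sym2 V) (hf : f ∈ G.edgeSet) {A B : Set (BondConfig V)}
    (hA : IsUpperSet A) (hB : IsUpperSet B) (hAm : MeasurableSet A) (hBm : MeasurableSet B)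
    (T : Finset (Sym2 V)) (hfT : f ∉ T) :
    ((bondPercolation G p).prod (bondPercolation G p)).real
        {y : BondConfig V × BondConfig V | y.1 ∈ A ∧ resample (↑T : Set (Sym2 V)) y ∈ B} -
      ((bondPercolation G p).prod (bondPercolation G p)).real
        {y : BondConfig V × BondConfig V | y.1 ∈ A ∧ resample (↑(insert f T) : Set (Sym2 V)) y ∈ B} =
      (p : ℝ) * (1 - (p : ℝ)) * ((bondPercolation G p).prod (bondPercolation G p)).real
        {y : BondConfig V × BondConfig V | IsPivotal A f y.1 ∧ IsPivotal B f (resample (↑T : Set (Sym2 V)) y)} := by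
  set P := bondPercolation G p with hP
  set PP := P.prod P with hPP
  set ξ : BondConfig V × BondConfig V → BondConfig V := resample (↑T : Set (Sym2 V)) with hξ
  have hξm : Measurable ξ := measurable_resample _
  -- the pieces `a_i`, `b_j`
  set a : Finset (Sym2 V) → BondConfig V × BondConfig V → ℝ :=
    fun i y => A.indicator 1 (y.1 \ ↑({f} : Finset (Sym2 V)) ∪ ↑i) with ha
  set b : Finset (Sym2 V) → BondConfig V × BondConfig V → ℝ :=
    fun j y => B.indicator 1 (ξ y \ {f} ∪ ↑j) with hb
  have ham : ∀ i, Measurable (a i) := fun i =>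
    (measurable_one.indicator hAm).comp ((measurable_sdiff_union {f} _).comp measurable_fst)
  have hbm : ∀ j, Measurable (b j) := fun j => by
    refine (measurable_one.indicator hBm).comp ?_
    have h1 : Measurable fun ζ : BondConfig V => ζ \ {f} ∪ (↑j : Set (Sym2 V)) :=
      measurable_set_iff.2 fun e => by
        simp only [Set.mem_union, Set.mem_sdiff, Set.mem_singleton_iff, Finset.mem_coe]
        exact ((measurable_set_mem e).and measurable_const).or measurable_const
    exact h1.comp hξm
  have ha1 : ∀ i y, |a i y| ≤ 1 := fun i y => by
    simp only [ha]; exact abs_indicator_one_le _ _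
  have hb1 : ∀ j y, |b j y| ≤ 1 := fun j y => by
    simp only [hb]; exact abs_indicator_one_le _ _
  set D : Finset (Sym2 V) → Finset (Sym2 V) → ℝ := fun i j => ∫ y, a i y * b j y ∂PP with hD
  have hint : ∀ i j, Integrable (fun y => a i y * b j y) PP := fun i j =>
    Integrable.of_bound ((ham i).mul (hbm j)).aestronglyMeasurable 1
      (ae_of_all _ fun y => by
        rw [Real.norm_eq_abs, abs_mul]
        exact mul_le_one₀ (ha1 i y) (abs_nonneg _) (hb1 j y))
  -- the two events as integrals of `H_T = 𝟙_A(ω) 𝟙_B(ξ)` and `H_{T∪f}`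
  set HT : BondConfig V × BondConfig V → ℝ := fun y => A.indicator 1 y.1 * B.indicator 1 (ξ y) with hHT
  set HT' : BondConfig V × BondConfig V → ℝ :=
    fun y => A.indicator 1 y.1 * B.indicator 1 (resample (↑(insert f T) : Set (Sym2 V)) y) with hHT'
  have hHTm : Measurable HT :=
    ((measurable_one.indicator hAm).comp measurable_fst).mul ((measurable_one.indicator hBm).comp hξm)
  have hHT'm : Measurable HT' :=
    ((measurable_one.indicator hAm).comp measurable_fst).mul
      ((measurable_one.indicator hBm).comp (measurable_resample _))
  have hHT1 : ∀ y, |HT y| ≤ 1 := fun y => by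
    simp only [hHT, abs_mul]
    exact mul_le_one₀ (abs_indicator_one_le _ _) (abs_nonneg _) (abs_indicator_one_le _ _)
  have hHT'1 : ∀ y, |HT' y| ≤ 1 := fun y => by
    simp only [hHT', abs_mul]
    exact mul_le_one₀ (abs_indicator_one_le _ _) (abs_nonneg _) (abs_indicator_one_le _ _)
  have hev1 : PP.real {y : BondConfig V × BondConfig V | y.1 ∈ A ∧ ξ y ∈ B} = ∫ y, HT y ∂PP := by
    have hset : {y : BondConfig V × BondConfig V | y.1 ∈ A ∧ ξ y ∈ B} = (Prod.fst ⁻¹' A) ∩ (ξ ⁻¹' B) := rfl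
    rw [hset, ← integral_indicator_one ((measurable_fst hAm).inter (hξm hBm))]
    refine integral_congr_ae (ae_of_all _ fun y => ?_)
    simp only [hHT]
    rw [Set.inter_indicator_one]
    rfl
  have hev2 : PP.real {y : BondConfig V × BondConfig V | y.1 ∈ A ∧ resample (↑(insert f T) : Set (Sym2 V)) y ∈ B} =
      ∫ y, HT' y ∂PP := by
    have hset : {y : BondConfig V × BondConfig V | y.1 ∈ A ∧ resample (↑(insert f T) : Set (Sym2 V)) y ∈ B} =
        (Prod.fst ⁻¹' A) ∩ (resample (↑(insert f T) : Set (Sym2 V)) ⁻¹' B) := rfl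
    rw [hset, ← integral_indicator_one ((measurable_fst hAm).inter (measurable_resample _ hBm))]
    refine integral_congr_ae (ae_of_all _ fun y => ?_)
    simp only [hHT']
    rw [Set.inter_indicator_one]
    rfl
  -- two-bit expansions
  have hexp1 := twoReplica_twoBit_expansion G p f hHTm hHT1
  have hexp2 := twoReplica_twoBit_expansion G p f hHT'm hHT'1
  -- identify the expanded integrands with `a_i b_i` resp. `a_i b_j`
  have hsub : ∀ i ∈ ({f} : Finset (Sym2 V)).powerset, i ⊆ {f} := fun i hi => Finset.mem_powerset.1 hi
  have hid1 : ∀ i ∈ ({f} : Finset (Sym2 V)).powerset, ∀ j ∈ ({f} : Finset (Sym2 V)).powerset,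
      ∫ y, HT (y.1 \ ↑({f} : Finset (Sym2 V)) ∪ ↑i, y.2 \ ↑({f} : Finset (Sym2 V)) ∪ ↑j) ∂PP = D i i := by
    intro i hi j hj
    refine integral_congr_ae (ae_of_all _ fun y => ?_)
    simp only [hHT, hξ, ha, hb]
    rw [resample_sdiff_union_of_notMem hfT i j (hsub i hi) (hsub j hj)]
  have hid2 : ∀ i ∈ ({f} : Finset (Sym2 V)).powerset, ∀ j ∈ ({f} : Finset (Sym2 V)).powerset,
      ∫ y, HT' (y.1 \ ↑({f} : Finset (Sym2 V)) ∪ ↑i, y.2 \ ↑({f} : Finset (Sym2 V)) ∪ ↑j) ∂PP = D i j := by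
    intro i hi j hj
    refine integral_congr_ae (ae_of_all _ fun y => ?_)
    simp only [hHT', hξ, ha, hb]
    rw [resample_insert_sdiff_union_of_notMem hfT i j (hsub i hi) (hsub j hj)]
  -- the weights
  obtain ⟨hw0, hw1⟩ := real_setOf_obs_singleton G p f hf
  -- rewrite everything as explicit four-term sums
  have hne : (∅ : Finset (Sym2 V)) ≠ {f} := (Finset.singleton_ne_empty f).symm
  have h0 : (∅ : Finset (Sym2 V)) ∈ ({f} : Finset (Sym2 V)).powerset := Finset.mem_powerset.2 (Finset.empty_subset _)
  have h1 : ({f} : Finset (Sym2 V)) ∈ ({f} : Finset (Sym2 V)).powerset := Finset.mem_powerset.2 subset_rfl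
  rw [hev1, hev2, hexp1, hexp2]
  rw [powerset_singleton_edge, Finset.sum_pair hne, Finset.sum_pair hne, Finset.sum_pair hne, Finset.sum_pair hne,
    Finset.sum_pair hne, Finset.sum_pair hne]
  rw [hid1 ∅ h0 ∅ h0, hid1 ∅ h0 {f} h1, hid1 {f} h1 ∅ h0, hid1 {f} h1 {f} h1,
    hid2 ∅ h0 ∅ h0, hid2 ∅ h0 {f} h1, hid2 {f} h1 ∅ h0, hid2 {f} h1 {f} h1, hw0, hw1]
  -- the co-pivotal integral
  have hpiv : PP.real {y : BondConfig V × BondConfig V | IsPivotal A f y.1 ∧ IsPivotal B f (ξ y)} =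
      D ∅ ∅ + D {f} {f} - D ∅ {f} - D {f} ∅ := by
    have hmeas : MeasurableSet {y : BondConfig V × BondConfig V | IsPivotal A f y.1 ∧ IsPivotal B f (ξ y)} :=
      (measurable_fst (measurableSet_setOf_isPivotal' hAm f)).inter (hξm (measurableSet_setOf_isPivotal' hBm f))
    rw [← integral_indicator_one hmeas]
    have i1 : Integrable (fun y => a ∅ y * b ∅ y + a {f} y * b {f} y) PP := (hint ∅ ∅).add (hint {f} {f})
    have i2 : Integrable (fun y => a ∅ y * b ∅ y + a {f} y * b {f} y - a ∅ y * b {f} y) PP := i1.sub (hint ∅ {f})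
    rw [show D ∅ ∅ + D {f} {f} - D ∅ {f} - D {f} ∅ =
        ∫ y, (a ∅ y * b ∅ y + a {f} y * b {f} y - a ∅ y * b {f} y - a {f} y * b ∅ y) ∂PP by
      rw [integral_sub i2 (hint {f} ∅), integral_sub i1 (hint ∅ {f}), integral_add (hint ∅ ∅) (hint {f} {f})]]
    refine integral_congr_ae (ae_of_all _ fun y => ?_)
    have hfa := indicator_insert_sub_indicator_sdiff hA f y.1
    have hfb := indicator_insert_sub_indicator_sdiff hB f (ξ y)
    obtain ⟨e0, e1⟩ := sdiff_union_singleton_cases (V := V) f y.1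
    have e0' : ξ y \ {f} ∪ (↑(∅ : Finset (Sym2 V)) : Set (Sym2 V)) = ξ y \ {f} := by simp
    have e1' : ξ y \ {f} ∪ (↑({f} : Finset (Sym2 V)) : Set (Sym2 V)) = insert f (ξ y) := by simp
    have key : (a {f} y - a ∅ y) * (b {f} y - b ∅ y) =
        ({ω' : BondConfig V | IsPivotal A f ω'}.indicator (1 : BondConfig V → ℝ) y.1) *
          ({ω' : BondConfig V | IsPivotal B f ω'}.indicator (1 : BondConfig V → ℝ) (ξ y)) := by
      simp only [ha, hb]
      rw [e0, e1, e0', e1', hfa, hfb]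
    have hind : ({y : BondConfig V × BondConfig V | IsPivotal A f y.1 ∧ IsPivotal B f (ξ y)}).indicator
        (1 : BondConfig V × BondConfig V → ℝ) y =
        ({ω' : BondConfig V | IsPivotal A f ω'}.indicator (1 : BondConfig V → ℝ) y.1) *
          ({ω' : BondConfig V | IsPivotal B f ω'}.indicator (1 : BondConfig V → ℝ) (ξ y)) := by
      have : {y : BondConfig V × BondConfig V | IsPivotal A f y.1 ∧ IsPivotal B f (ξ y)} =
          (Prod.fst ⁻¹' {ω' | IsPivotal A f ω'}) ∩ (ξ ⁻¹' {ω' | IsPivotal B f ω'}) := rfl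
      rw [this, Set.inter_indicator_one]
      rfl
    rw [hind, ← key]
    ring
  rw [hpiv]
  ring




end Summit.CriticalPhenomena.PercolationContinuityZ3.Theorems.TetrahedronHarrisGap

end
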